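import Literature.AlgebraicGeometry.Resolution.LogRegularResolution
import Mathlib.AlgebraicGeometry.AffineScheme
import HarnessLib

/-!
# Logarithmically regular schemes with a Zariski fs atlas, and Kato's resolution theorem
# (general, multi-chart form) — Kato 1994 (10.4), Nizioł 2006 Thm. 5.8

Topic: `Literature/AlgebraicGeometry/Resolution`. `LogRegularResolution.lean` vendors Kato's
theorem "(10.4): a quasi-compact log regular scheme with Zariski fs charts is resolved by a
subdivision of its fan" ONLY for `X = Spec A` with ONE global chart, and records the general
statement as a TODO. This file supplies the general (several-charts) form, still without
introducing sheaves of monoids: a **log-regular atlas** on a scheme `X` (`LogRegularAtlas X`) is a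
finite family of affine opens covering `X`, each carrying one fs chart
`φᵢ : Pᵢ → (Γ(X, Uᵢ), ·)` (`Pᵢ ⊆ ℤ^{nᵢ}` finitely generated, saturated, spanning) which is log
regular at every prime (`LogChart.IsLogRegularAt`, Kato Def. (2.1)), and such that on overlaps the
charts define THE SAME log structure: at every `x ∈ Uᵢ ∩ Uⱼ` the submonoids of the local ring
`𝒪_{X,x}` generated by its units together with the germs of `φᵢ(Pᵢ)`, resp. `φⱼ(Pⱼ)`, coincide
(`LogRegularAtlas.compat`). For a log regular log scheme `(X, M)` the structure map
`M → 𝒪_X` is injective (Nizioł 2006, Lemma 2.4(1); Kato 1994, proof of (4.1)), so `M` IS the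
subsheaf of monoids of `𝒪_X` generated by `𝒪_X^*` and the chart images, and two Zariski fs charts
around `x` define the same log structure iff these submonoids of `𝒪_{X,x}` agree — the rendering
is faithful to Kato's setting ((1.5) condition (S): "`X` is covered by open sets `U_λ` with charts
`P_λ → M|_{U_λ}` by fs monoids").

* `LogRegularAtlas X` — the structure just described;
* `Kato1994_logRegular_hasResolution_general` — NAMED FACT: a scheme admitting a log-regular atlas
  has a resolution of singularities (`Scheme.HasResolution`); Kato 1994 (10.4) with (9.8) =
  [KKMS] Ch. I Thm. 11, (9.11), (10.3); equivalently Nizioł 2006 Thm. 5.8 (by a log blow-up).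

## What is NOT here

No proof; no log structures as sheaves of monoids, no étale charts (Zariski only, as in Kato's
paper and Nizioł's "Zariski log schemes"); no statement that the resolution is a log blow-up,
projective, or an isomorphism over the locus where the log structure is trivial; no comparison
theorem with the one-chart fact `Kato1994_logRegular_hasResolution` beyond the remark that a
one-chart atlas on `Spec A` is the special case `ι = Unit`, `U = ⊤`.

## Sources

* [Kato1994] K. Kato, *Toric singularities*, Amer. J. Math. 116 (1994) 1073–1099: (1.5) (S),
  Def. (2.1), Thm. (4.1) and its proof (injectivity of `M_x → 𝒪_{X,x}`), (9.8)–(9.11), (10.3),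
  (10.4).
* [Niziol2006] W. Nizioł, *Toric singularities: log-blow-ups and global resolutions*,
  J. Algebraic Geom. 15 (2006) 1–29: §2.1 (Zariski log schemes), Lemma 2.4, Thm. 5.8.
-/

noncomputable section

open AlgebraicGeometry TopologicalSpace CategoryTheory Opposite

namespace Literature.AlgebraicGeometry.Resolution

universe u

/-- The **stalk monoid of a chart at a point**: for an open `U ∋ x` of a scheme `X` and a monoid
homomorphism `φ : P → (Γ(X, U), ·)`, the submonoid of the local ring `𝒪_{X,x}` generated by its
units and the germs at `x` of the elements `φ(P)` — the stalk at `x` of the log structure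
associated to the chart, viewed inside `𝒪_{X,x}` (faithful when the structure map is injective,
e.g. for log regular structures: Nizioł 2006, Lemma 2.4(1)). [cite: Niziol2006, §2.1 and Lemma 2.4] -/
def chartStalkMonoid {X : Scheme.{u}} (U : X.Opens) {P : Type*} [MulOneClass P]
    (φ : P →* Γ(X, U)) (x : X) (hx : x ∈ U) : Submonoid (X.presheaf.stalk x) :=
  IsUnit.submonoid (X.presheaf.stalk x) ⊔
    (MonoidHom.mrange φ).map (X.presheaf.germ U x hx).hom.toMonoidHom

/-- A **log-regular Zariski fs atlas** on a scheme `X` (Kato 1994, (1.5) condition (S) with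
Def. (2.1) at every point; Nizioł 2006 §2.1–2.2 "log-regular Zariski log scheme"): finitely many
affine opens `U i` covering `X`; on each, ONE chart `φ i : P i → (Γ(X, U i), ·)` by a finitely
generated submonoid `P i ⊆ ℤ^{n i}` saturated in `ℤ^{n i}` and spanning it (an fs monoid with
`(P i)ᵍᵖ = ℤ^{n i}`), log regular at every prime of `Γ(X, U i)` (`LogChart.IsLogRegularAt`); and
on overlaps the charts generate the same stalk monoids (`chartStalkMonoid`), i.e. define the same
log structure. [cite: Kato1994, (1.5) and Def. (2.1)] -/
structure LogRegularAtlas (X : Scheme.{u}) where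
  /-- index type of the charts (finite) -/
  ι : Type
  /-- finitely many charts -/
  finite : Finite ι
  /-- the affine opens carrying the charts -/
  U : ι → X.affineOpens
  /-- they cover `X` -/
  iSup_eq_top : ⨆ i, (U i : X.Opens) = ⊤
  /-- the Noetherian hypothesis of Kato's theorem, chartwise -/
  isNoetherianRing : ∀ i, IsNoetherianRing Γ(X, (U i : X.Opens))
  /-- rank of the ambient lattice of the `i`-th chart -/
  n : ι → ℕ
  /-- the fs monoid of the `i`-th chart, inside `ℤ^{n i}` -/
  P : ∀ i, AddSubmonoid (Fin (n i) → ℤ)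
  /-- finitely generated -/
  fg : ∀ i, (P i).FG
  /-- saturated in `ℤ^{n i}` -/
  saturated : ∀ i (v : Fin (n i) → ℤ) (k : ℕ), 0 < k → k • v ∈ P i → v ∈ P i
  /-- spanning `ℤ^{n i}` -/
  span_eq_top : ∀ i, Submodule.span ℤ (P i : Set (Fin (n i) → ℤ)) = ⊤
  /-- the chart -/
  φ : ∀ i, Multiplicative (P i) →* Γ(X, (U i : X.Opens))
  /-- log regular at every prime of every chart (Kato Def. (2.1)) -/
  isLogRegularAt : ∀ i (𝔭 : Ideal Γ(X, (U i : X.Opens))) [𝔭.IsPrime],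
    LogChart.IsLogRegularAt (P i) (φ i) 𝔭
  /-- the charts define the same log structure on overlaps -/
  compat : ∀ i j (x : X) (hi : x ∈ (U i : X.Opens)) (hj : x ∈ (U j : X.Opens)),
    chartStalkMonoid (U i : X.Opens) (φ i) x hi = chartStalkMonoid (U j : X.Opens) (φ j) x hj

/-- NAMED FACT — **Kato 1994, (10.4), general form: a quasi-compact, locally Noetherian,
logarithmically regular scheme with Zariski fs charts admits a resolution of singularities** (by
the subdivision (9.8) = [KKMS] Ch. I Thm. 11 of its fan; the resulting morphism is proper (9.11)
and birational with regular source (10.3)); equivalently Nizioł 2006, Thm. 5.8: "Any log-regular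
Zariski scheme `(X, M_X)` can be desingularized by a log-blow-up". Rendered with
`LogRegularAtlas` (finitely many affine Zariski charts, so `X` is quasi-compact and locally
Noetherian) and the weak conclusion `Scheme.HasResolution` (some proper birational `X' → X` with
`X'` regular). The one-chart affine case is `Kato1994_logRegular_hasResolution`
(`LogRegularResolution.lean`). Users take `(h : Kato1994_logRegular_hasResolution_general)`.
[cite: Kato1994, (10.4) with (9.8), (9.11), (10.3)] [cite: Niziol2006, Thm. 5.8] -/
def Kato1994_logRegular_hasResolution_general : Prop :=
  ∀ (X : Scheme.{u}), Nonempty (LogRegularAtlas X) → Scheme.HasResolution X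

end Literature.AlgebraicGeometry.Resolution

end
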